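import Summits.Ventures.Crystal3D.Bulk.LinkCharts
import HarnessLib

/-!
# The vertex-from-corner chart of `p5cert.py` (A lineage, P5-CERT tables) in the kernel: every
# unit vector at spherical distance `s` from `a` is `cos s · a + sin s · (cos u · t₁ ± sin u · (a × t₁))`
# with `u ∈ [0, π]` its corner angle at `a` from the arc towards `b`

HONEST FRAMING. Part of the venture `Summits/Ventures/Crystal3D` (cell `pub-crystal3d`, phase 2;
seat p2, PROMOTION-AUDIT prep). Elementary linear algebra in `ℝ³` on top of `Bulk/LinkCharts.lean`;
nothing here asserts anything about GAP(1.26), books or replays a kill, or moves a census number.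
Purpose (A-family dossier `A-FAMILY-AUDIT-DOSSIER-engine4-g8.md` §2.2 row P5-CERT + F-A5; memo
A6 (1) «P5-CERT parametrisation completeness ×1»): `p5cert.py` (sha256:16 `6d842cd214dcfef8`)
certifies outer polygons for the adjacent-corner pairs of a pentagon face by covering the PARAMETER
domain `(u₀, u₁) ∈ [lo₀, 180°] × [lo₁, 180°]` with boxes; its parametrisation (l.66–76, `do_box`
l.77–110) is: gauge `A1 = (0,0,1)`, `A0 = (sin s₀, 0, cos s₀)`; **`A2 = sph_point_from_iv(A1, A0, s₁,
u₁, +1)`**, **`A4 = sph_point_from_iv(A0, A1, s₄, u₀, −1)`** where (l.53–60)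
`sph_point_from(a, b, dist, ang, σ) = cos(dist)·a + sin(dist)·(cos(ang)·t1 + sin(ang)·σ t2)`,
`t1 = normalise(b − (a·b) a)`, `t2 = a × t1`; and `A3 = al·A2 + be·A4 ± g·(A2 × A4)` with
`al = (c23 − μ c43)/den`, `be = (c43 − μ c23)/den`, `g² = (1 − al² − be² − 2 al be μ)/den`,
`den = 1 − μ²` (l.100–108), BOTH signs. Its completeness premise («every admissible pentagon has
parameters in the domain and is one of the constructed ones») has the geometric core:
(i) the gauge — `fs4_gauge` / `gauge_pole` of `Bulk/Fs4Charts.lean` (first vertex at the pole,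
second in the half-plane `y = 0`); (ii) the frame: `t1 = (b − (a·b) a)/√(1 − (a·b)²)` is a unit
vector `⊥ a` with `a × t1 = (a × b)/√(1 − (a·b)²)` — this IS `link_frame` of `Bulk/LinkCharts.lean`
with `e₀ = b` (not restated); THIS file: **`p5cert_sphPoint_chart`**
(every unit `X` with `X·a = cos s`, `0 < s < π`, is `sph_point_from(a, b, s, u, σ)` for some
`u ∈ [0, π]` and a sign `σ = ±1` — both `side_sign`s together are EXHAUSTIVE) and
**`p5cert_sphPoint_corner`** (for such an `X` the tangent components at `a` satisfy
`⟪X − (X·a) a, b − (a·b) a⟫ = sin s · √(1 − (a·b)²) · cos u` with norms `sin s` and `√(1 − (a·b)²)`, so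
the corner angle at `a` between the arcs to `b` and to `X` — `arccos` of the normalised tangent
inner product, the tree's `corner` — is exactly `u`: the parameter IS the corner);
(iii) the fifth vertex — `twoAnchor_chart` (`Bulk/LinkCharts.lean`; `fs4_trilat` form in
`Bulk/Fs4Charts.lean`): `g²·den = 1 − al² − be² − 2 al be μ` verbatim, both signs exhaustive.

What stays OUTSIDE the kernel: the BOX COVER of the parameter domain and the interval inclusion of
every corner / turn / diagonal on a box (mpmath.iv), the hull + `1e-6` margin + outward-safe
thinning (alp.py `p5cert_pair0`), the rotation of the construction over the five pairs, and that the
admissible set used (sides exact, listed diagonals `≥` minimum, corners `≥` R2, all turns of one sign)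
is implied by the kernel rows (side lengths, `GapFaceMeet` loose diagonals, R-min, Lemma L) — the
dossier's row dictionary, not a new premise.
-/

noncomputable section

namespace Summit.Ventures.Crystal3D

open Matrix

section P5cert

/-- **p5cert's vertex-from-corner chart is exhaustive** (`sph_point_from_iv`, l.53–60, with both
`side_sign`s): for unit `a, b` with `(a·b)² < 1`, every unit `X` at spherical distance `s ∈ (0, π)`
from `a` (`X·a = cos s`) is `cos s · a + sin s · (cos u · t1 + (σ sin u) · (a × t1))` for some
`u ∈ [0, π]` and `σ ∈ {1, −1}`. [folklore] -/
theorem p5cert_sphPoint_chart {a b X : Fin 3 → ℝ} (ha : a ⬝ᵥ a = 1) (hb : b ⬝ᵥ b = 1)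
    (hg : (b ⬝ᵥ a) ^ 2 < 1) (hX : X ⬝ᵥ X = 1) {s : ℝ} (hs0 : 0 < s) (hsπ : s < Real.pi)
    (hXa : X ⬝ᵥ a = Real.cos s) :
    ∃ u σ : ℝ, 0 ≤ u ∧ u ≤ Real.pi ∧ (σ = 1 ∨ σ = -1) ∧
      X = Real.cos s • a + Real.sin s •
        (Real.cos u • ((Real.sqrt (1 - (b ⬝ᵥ a) ^ 2))⁻¹ • (b - (b ⬝ᵥ a) • a)) +
          (σ * Real.sin u) • (a ⨯₃ ((Real.sqrt (1 - (b ⬝ᵥ a) ^ 2))⁻¹ • (b - (b ⬝ᵥ a) • a)))) := by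
  obtain ⟨h1, h2, -⟩ := link_frame ha hb hg
  have hsin : 0 < Real.sin s := Real.sin_pos_of_pos_of_lt_pi hs0 hsπ
  have hκ : Real.cos s ^ 2 < 1 := by nlinarith [Real.sin_sq_add_cos_sq s]
  obtain ⟨α, hα⟩ := oneAnchor_chart ha h1 h2 hκ hX hXa
  have hsq : Real.sqrt (1 - Real.cos s ^ 2) = Real.sin s := by
    rw [← Real.abs_sin_eq_sqrt_one_sub_cos_sq, abs_of_pos hsin]
  rw [hsq] at hα
  -- `u = arccos (cos α) ∈ [0, π]`, `cos u = cos α`, `sin u = |sin α|`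
  refine ⟨Real.arccos (Real.cos α), if 0 ≤ Real.sin α then 1 else -1, Real.arccos_nonneg _,
    Real.arccos_le_pi _, ?_, ?_⟩
  · by_cases h : 0 ≤ Real.sin α <;> simp [h]
  · have hc : Real.cos (Real.arccos (Real.cos α)) = Real.cos α :=
      Real.cos_arccos (Real.neg_one_le_cos α) (Real.cos_le_one α)
    have hsu : Real.sin (Real.arccos (Real.cos α)) = |Real.sin α| := by
      rw [Real.sin_arccos, Real.abs_sin_eq_sqrt_one_sub_cos_sq]
    have hs' : (if 0 ≤ Real.sin α then (1:ℝ) else -1) * |Real.sin α| = Real.sin α := by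
      by_cases h : 0 ≤ Real.sin α
      · rw [if_pos h, abs_of_nonneg h, one_mul]
      · rw [if_neg h, abs_of_neg (lt_of_not_ge h)]; ring
    rw [hc, hsu, hs']
    exact hα

/-- **The parameter IS the corner angle** (`corner_iv` l.61–65 evaluates exactly this normalised
tangent inner product): for `X = sph_point_from(a, b, s, u, σ)` the tangent components at `a`
satisfy `⟪X − (X·a) a, b − (b·a) a⟫ = sin s · √(1 − (b·a)²) · cos u`, with
`‖b − (b·a) a‖² = 1 − (b·a)²` and `‖X − (X·a) a‖² = sin² s`; hence the cosine of the corner angle at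
`a` between the arcs to `b` and to `X` is `cos u`, i.e. the corner is `u` for `u ∈ [0, π]`. [folklore] -/
theorem p5cert_sphPoint_corner {a b : Fin 3 → ℝ} (ha : a ⬝ᵥ a = 1) (hb : b ⬝ᵥ b = 1)
    (hg : (b ⬝ᵥ a) ^ 2 < 1) (s u σ : ℝ) (hσ : σ = 1 ∨ σ = -1) :
    let t1 : Fin 3 → ℝ := (Real.sqrt (1 - (b ⬝ᵥ a) ^ 2))⁻¹ • (b - (b ⬝ᵥ a) • a)
    let X : Fin 3 → ℝ := Real.cos s • a + Real.sin s • (Real.cos u • t1 + (σ * Real.sin u) • (a ⨯₃ t1))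
    X ⬝ᵥ a = Real.cos s ∧
      (X - (X ⬝ᵥ a) • a) ⬝ᵥ (b - (b ⬝ᵥ a) • a) =
        Real.sin s * Real.sqrt (1 - (b ⬝ᵥ a) ^ 2) * Real.cos u ∧
      (b - (b ⬝ᵥ a) • a) ⬝ᵥ (b - (b ⬝ᵥ a) • a) = 1 - (b ⬝ᵥ a) ^ 2 ∧
      (X - (X ⬝ᵥ a) • a) ⬝ᵥ (X - (X ⬝ᵥ a) • a) = Real.sin s ^ 2 := by
  intro t1 X
  obtain ⟨h1, h2, -⟩ := link_frame ha hb hg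
  set q := Real.sqrt (1 - (b ⬝ᵥ a) ^ 2) with hq
  have hq0 : 0 < q := Real.sqrt_pos.2 (by linarith)
  have hq2 : q ^ 2 = 1 - (b ⬝ᵥ a) ^ 2 := Real.sq_sqrt (by linarith)
  -- frame facts (for `t1` and `a × t1`)
  have ht1t1 : t1 ⬝ᵥ t1 = 1 := h1
  have ht1a : t1 ⬝ᵥ a = 0 := h2
  have hat1 : a ⬝ᵥ t1 = 0 := by rw [dotProduct_comm]; exact h2
  have hna : (a ⨯₃ t1) ⬝ᵥ a = 0 := by rw [dotProduct_comm]; exact dot_self_cross a t1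
  have hnt1 : (a ⨯₃ t1) ⬝ᵥ t1 = 0 := by rw [dotProduct_comm]; exact dot_cross_self a t1
  have ht1n : t1 ⬝ᵥ (a ⨯₃ t1) = 0 := dot_cross_self a t1
  have hnn : (a ⨯₃ t1) ⬝ᵥ (a ⨯₃ t1) = 1 := by rw [cross_dot_cross, ha, ht1t1, hat1, ht1a]; ring
  have hσ2 : σ ^ 2 = 1 := by rcases hσ with h | h <;> rw [h] <;> norm_num
  -- `b − (b·a) a = q • t1`
  have hbt : b - (b ⬝ᵥ a) • a = q • t1 := by
    show b - (b ⬝ᵥ a) • a = q • ((Real.sqrt (1 - (b ⬝ᵥ a) ^ 2))⁻¹ • (b - (b ⬝ᵥ a) • a))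
    rw [← hq, smul_smul, mul_inv_cancel₀ hq0.ne', one_smul]
  have hXa : X ⬝ᵥ a = Real.cos s := by
    simp only [X, add_dotProduct, smul_dotProduct, smul_eq_mul, ha, ht1a, hna]; ring
  have hXt : X - (X ⬝ᵥ a) • a = Real.sin s • (Real.cos u • t1 + (σ * Real.sin u) • (a ⨯₃ t1)) := by
    rw [hXa]; simp only [X]; abel
  refine ⟨hXa, ?_, ?_, ?_⟩
  · rw [hXt, hbt]
    simp only [smul_dotProduct, dotProduct_smul, add_dotProduct, smul_eq_mul, ht1t1, hnt1]; ring
  · rw [hbt]; simp only [smul_dotProduct, dotProduct_smul, smul_eq_mul, ht1t1]; rw [← hq2]; ring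
  · rw [hXt]
    simp only [smul_dotProduct, dotProduct_smul, add_dotProduct, dotProduct_add, smul_eq_mul, ht1t1,
      hnn, hnt1, ht1n]
    have := Real.sin_sq_add_cos_sq u
    linear_combination (Real.sin s ^ 2 * Real.sin u ^ 2) * hσ2 + Real.sin s ^ 2 * this

/-- **p5cert's fifth vertex: both branches are exhaustive, with `g²` AS CODED** (l.100–108:
`al = (c23 − μ·c43)/den`, `be = (c43 − μ·c23)/den`, `g2 = (1 − al² − be² − 2·al·be·μ)/den`,
`A3 = al·A2 + be·A4 ± g·(A2 × A4)`): unit anchors `A2, A4` with `μ = A2·A4`, `μ² < 1`, and a unit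
`A3` at the two side targets; then `A3` is one of the two constructed points. [folklore] -/
theorem p5cert_fifth_vertex {A2 A4 A3 : Fin 3 → ℝ} (h2 : A2 ⬝ᵥ A2 = 1) (h4 : A4 ⬝ᵥ A4 = 1)
    (hμ : (A2 ⬝ᵥ A4) ^ 2 < 1) {c23 c43 : ℝ} (ht2 : A3 ⬝ᵥ A2 = c23) (ht4 : A3 ⬝ᵥ A4 = c43)
    (h3 : A3 ⬝ᵥ A3 = 1) :
    ∃ g : ℝ,
      A3 = ((c23 - (A2 ⬝ᵥ A4) * c43) / (1 - (A2 ⬝ᵥ A4) ^ 2)) • A2 +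
          ((c43 - (A2 ⬝ᵥ A4) * c23) / (1 - (A2 ⬝ᵥ A4) ^ 2)) • A4 + g • (A2 ⨯₃ A4) ∧
      g ^ 2 = (1 - ((c23 - (A2 ⬝ᵥ A4) * c43) / (1 - (A2 ⬝ᵥ A4) ^ 2)) ^ 2
          - ((c43 - (A2 ⬝ᵥ A4) * c23) / (1 - (A2 ⬝ᵥ A4) ^ 2)) ^ 2
          - 2 * ((c23 - (A2 ⬝ᵥ A4) * c43) / (1 - (A2 ⬝ᵥ A4) ^ 2)) *
              ((c43 - (A2 ⬝ᵥ A4) * c23) / (1 - (A2 ⬝ᵥ A4) ^ 2)) * (A2 ⬝ᵥ A4)) /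
          (1 - (A2 ⬝ᵥ A4) ^ 2) := by
  obtain ⟨C, hA3, hC⟩ := twoAnchor_chart h2 h4 hμ ht2 ht4 h3
  have hden : 1 - (A2 ⬝ᵥ A4) ^ 2 ≠ 0 := by
    have : 0 < 1 - (A2 ⬝ᵥ A4) ^ 2 := by linarith
    exact this.ne'
  exact ⟨C, hA3, by rw [eq_div_iff hden, hC]⟩

end P5cert

end Summit.Ventures.Crystal3D
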